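import Literature.MathematicalPhysics.QuantumFieldTheory.Balaban1983to89.B2Eq324NestedRegions
import Literature.MathematicalPhysics.QuantumFieldTheory.Balaban1983to89.B2Restr216Lattice

/-!
# Bałaban, *(Higgs)₂,₃ quantum fields in a finite volume I*, CMP **85** (1982): the "prime" operation (1.16),
literally, and its interplay with the blocks (1.17)–(1.20)

p. 606, verbatim: *"Now let us gather together the definitions and notations used in the paper. For a lattice of an
arbitrary scale η, and also for its arbitrary subset Λ ⊂ ηZ^d, we define the "prime" operation
Λ′ = Λ ∩ LηZ^d. (1.16)"*; p. 607: *"Together with the operation ′, we introduce also a dual operation B: for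
Λ ⊂ ηZ^d, B(Λ) = ⋃_{x∈Λ} B(x) ⊂ L^{−1}ηZ^d. (1.18) The operations ′ and B can be iterated and we define
T^{(k+1)}_{L^{k+1}ε} = (T^{(k)}_{L^kε})′, k = 0, 1, 2, …, T^{(0)}_ε = T_ε. (1.19) From the definition of T_ε, and more
exactly, the definition of the numbers L_μ, it follows that all the above sets are the sums of the corresponding blocks,
i.e. T^{(k)}_{L^kε} = B(T^{(k+1)}_{L^{k+1}ε}), k = 0, 1, …, thus T_ε = B^k(T^{(k)}_{L^kε}). (1.20)"*.

WHAT THIS FILE ADDS.  The tree had (1.16) only in the block-union reading `B2Eq324NestedRegions.prime Λ`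
(= the coarse sites `y` whose whole block `B(y)` lies in `Λ`), which is what (1.16) gives on unions of blocks — the
only sets the papers apply it to — but is not the printed formula for an ARBITRARY `Λ`.  Here:
* `primeOp Λ` — (1.16) literally for every `Λ ⊂ T^{(k)}`: the points of the coarser lattice `T^{(k+1)} = LηZ^d ∩ T`
  (embedded by `HiggsLattice.emb`, (1.19)) lying in `Λ`;
* `primeOp_univ` ((1.19) `T^{(k+1)} = (T^{(k)})′`), `primeOp_inter` / `primeOp_mono` (′ is a set operation),
  `blockOf_emb` (the corner `y` of `B(y)` has block point `y`);
* `primeOp_eq_prime_of_isUnion`: on a union of blocks the literal (1.16) IS `B2Eq324NestedRegions.prime`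
  (and `prime_subset_primeOp` always);
* the duality with (1.18): `primeOp_blockSet` (`(B(Λ₁))′ = Λ₁`) and `blockSet_primeOp_of_isUnion` (`B(Λ′) = Λ` for a
  union of blocks — p. 607 *"all the above sets are the sums of the corresponding blocks"*); (1.20) itself is
  `B10StarCount.blockSet_univ`.
HONEST SCOPE.  Pure bookkeeping on the label tori of `HiggsLattice` (levels `k < K`, where one block step is an exact
integer division of labels); nothing quantitative.  Serves row B1.Eq1.16 of `ROWS-B1.md`.  Unit `lit-balaban-r14`
gen 22 (literature-prover-lit-balaban-r14-g22-0); HOME/FILED.md records the proposal.  Statement-level skeleton of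
published theorems with citation tags; proofs where landed; nothing here is a claim about the Yang–Mills mass gap.
-/

namespace Literature.MathematicalPhysics.QuantumFieldTheory.Balaban1983to89.B1Eq116PrimeOperation

open Literature.MathematicalPhysics.QuantumFieldTheory.Balaban1983to89.B2Eq324NestedRegions (prime mem_prime)
open Literature.MathematicalPhysics.QuantumFieldTheory.Balaban1983to89.B2Restr216Lattice (emb_mem_block)

variable {P : HiggsLattice.Params} {k : ℕ}

/-- **(1.16)** p. 606, literally: *"for its arbitrary subset Λ ⊂ ηZ^d, we define the "prime" operation Λ′ = Λ ∩ LηZ^d"*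
— for `Λ ⊂ T^{(k)}_η` (η = L^kε) the sites of the coarser torus `T^{(k+1)}_{Lη} ⊂ T^{(k)}_η` ((1.19); the inclusion is
`HiggsLattice.emb`, label `w ↦ L·w`) that lie in `Λ`, as a finite set of coarse sites. [cite: Balaban1982Higgs1, (1.16) p.606] -/
def primeOp (Λ : Finset (HiggsLattice.Site P k)) : Finset (HiggsLattice.Site P (k + 1)) :=
  Finset.univ.filter fun y => HiggsLattice.emb y ∈ Λ

/-- Membership in `Λ′`: `y ∈ Λ′ ↔ y ∈ Λ` (the coarse site read inside the fine lattice). [cite: Balaban1982Higgs1, (1.16) p.606] -/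
theorem mem_primeOp (Λ : Finset (HiggsLattice.Site P k)) (y : HiggsLattice.Site P (k + 1)) :
    y ∈ primeOp Λ ↔ HiggsLattice.emb y ∈ Λ := by
  simp [primeOp]

/-- **(1.19)** p. 607: `T^{(k+1)}_{L^{k+1}ε} = (T^{(k)}_{L^kε})′` — the prime of the whole lattice is the whole coarser
lattice. [cite: Balaban1982Higgs1, (1.19) p.607] -/
theorem primeOp_univ : primeOp (Finset.univ : Finset (HiggsLattice.Site P k)) = Finset.univ := by
  ext y
  simp [primeOp]

/-- `∅′ = ∅`. [cite: Balaban1982Higgs1, (1.16) p.606] -/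
theorem primeOp_empty : primeOp (∅ : Finset (HiggsLattice.Site P k)) = ∅ := by
  ext y
  simp [primeOp]

/-- `′` is intersection with a fixed set, hence commutes with `∩`: `(Λ₁ ∩ Λ₂)′ = Λ₁′ ∩ Λ₂′`. [cite: Balaban1982Higgs1, (1.16) p.606] -/
theorem primeOp_inter (Λ₁ Λ₂ : Finset (HiggsLattice.Site P k)) :
    primeOp (Λ₁ ∩ Λ₂) = primeOp Λ₁ ∩ primeOp Λ₂ := by
  ext y
  simp [primeOp, Finset.mem_inter]

/-- `′` is monotone. [cite: Balaban1982Higgs1, (1.16) p.606] -/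
theorem primeOp_mono {Λ₁ Λ₂ : Finset (HiggsLattice.Site P k)} (h : Λ₁ ⊆ Λ₂) : primeOp Λ₁ ⊆ primeOp Λ₂ := by
  intro y hy
  rw [mem_primeOp] at hy ⊢
  exact h hy

/-- The corner `y ∈ T^{(k+1)} ⊂ T^{(k)}` of the block `B(y)` has block point `y` ((1.17) with `x = y`; `k < K`).
[cite: Balaban1982Higgs1, (1.17) p.606] -/
theorem blockOf_emb (hk : k < P.K) (y : HiggsLattice.Site P (k + 1)) :
    HiggsLattice.blockOf (HiggsLattice.emb y) = y := by
  have h := emb_mem_block hk y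
  simpa [HiggsLattice.block] using h

/-- The block reading is always contained in the literal one: `{y : B(y) ⊂ Λ} ⊂ Λ′` (`k < K`). [cite: Balaban1982Higgs1, (1.16) p.606] -/
theorem prime_subset_primeOp (hk : k < P.K) (Λ : Finset (HiggsLattice.Site P k)) : prime Λ ⊆ primeOp Λ := by
  intro y hy
  rw [mem_primeOp]
  exact (mem_prime Λ y).mp hy _ (blockOf_emb hk y)

/-- **On a union of blocks the literal (1.16) IS the block reading** `B2Eq324NestedRegions.prime` (the coarse sites whose
block lies in `Λ`) — the case in which the papers use `′` ((1.19)–(1.20), II (3.22)); `k < K`. PROVED.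
[cite: Balaban1982Higgs1, (1.16) p.606, (1.20) p.607] -/
theorem primeOp_eq_prime_of_isUnion (hk : k < P.K) {Λ : Finset (HiggsLattice.Site P k)}
    (hΛ : ∀ x x' : HiggsLattice.Site P k, HiggsLattice.blockOf x = HiggsLattice.blockOf x' → (x ∈ Λ ↔ x' ∈ Λ)) :
    primeOp Λ = prime Λ := by
  ext y
  rw [mem_primeOp, mem_prime]
  constructor
  · intro hy x hx
    exact (hΛ x (HiggsLattice.emb y) (by rw [hx, blockOf_emb hk])).mpr hy
  · intro h
    exact h _ (blockOf_emb hk y)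

/-- **`(B(Λ₁))′ = Λ₁`** — the prime operation undoes the block operation (1.18) (`k < K`). PROVED. [cite: Balaban1982Higgs1, (1.18)–(1.20) p.607] -/
theorem primeOp_blockSet (hk : k < P.K) (Λ₁ : Finset (HiggsLattice.Site P (k + 1))) :
    primeOp (HiggsLattice.blockSet Λ₁) = Λ₁ := by
  ext y
  rw [mem_primeOp, HiggsLattice.mem_blockSet, blockOf_emb hk]

/-- **`B(Λ′) = Λ` for a union of blocks `Λ`** — p. 607: *"all the above sets are the sums of the corresponding blocks"*
((1.20) for `Λ = T^{(k)}`: `B10StarCount.blockSet_univ` with `primeOp_univ`); `k < K`. PROVED. [cite: Balaban1982Higgs1, (1.20) p.607] -/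
theorem blockSet_primeOp_of_isUnion (hk : k < P.K) {Λ : Finset (HiggsLattice.Site P k)}
    (hΛ : ∀ x x' : HiggsLattice.Site P k, HiggsLattice.blockOf x = HiggsLattice.blockOf x' → (x ∈ Λ ↔ x' ∈ Λ)) :
    HiggsLattice.blockSet (primeOp Λ) = Λ := by
  ext x
  rw [HiggsLattice.mem_blockSet, mem_primeOp]
  exact hΛ _ x (blockOf_emb hk _)

/-- A block union is recovered from its prime: `Λ = B(Λ′)`, so `x ∈ Λ ↔ x_1 ∈ Λ′` (`k < K`). [cite: Balaban1982Higgs1, (1.20) p.607] -/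
theorem mem_iff_blockOf_mem_primeOp (hk : k < P.K) {Λ : Finset (HiggsLattice.Site P k)}
    (hΛ : ∀ x x' : HiggsLattice.Site P k, HiggsLattice.blockOf x = HiggsLattice.blockOf x' → (x ∈ Λ ↔ x' ∈ Λ))
    (x : HiggsLattice.Site P k) : x ∈ Λ ↔ HiggsLattice.blockOf x ∈ primeOp Λ := by
  rw [mem_primeOp]
  exact hΛ x _ (blockOf_emb hk _).symm

end Literature.MathematicalPhysics.QuantumFieldTheory.Balaban1983to89.B1Eq116PrimeOperation
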